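import Summits.NavierStokesRegularity.NavierStokesRegularity.Theorems.PerpetualPumpAveragedTypeIBlowupOneStepCoreTools
import Summits.NavierStokesRegularity.NavierStokesRegularity.Theorems.PerpetualPumpAveragedTypeIBlowupOneStepCoreTube

/-!
# Crux `PerpetualPump.AveragedTypeIBlowup` (stmt-NavierStokesRegularity-1835), line `Sketch`: `stub_oneStepCore`,
# the window one-step theorem from its pre-ignition / pulse / hand-off packages (lead c1)
-/
noncomputable section
set_option linter.dupNamespace false

open Set MeasureTheory
namespace Summit.NavierStokesRegularity.NavierStokesRegularity.Theorems.PerpetualPumpAveragedTypeIBlowup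

set_option maxHeartbeats 1600000 in
/-- **Registered stub `stub_oneStepCore`: the window one-step theorem from its three phase packages** (first
ignition time of the front bond as a first zero of `w_n² − b_n/100`; no ignition ⇒ `T < t₀ + 3/R n` by NEW-1
against `b_lo ≥ 10⁴ + 40 + 5 log(1/ε̄)`; pulse horizon sticking out of `[0,T]` ⇒ tube from `Pre`/`Pul`; full pulse
horizon inside ⇒ `stub_handoff`). [cite: Tao2016AveragedNS, §5] -/
theorem stub_oneStepCore :
    (∀ (ε₀ D εb θ η F blo bhi : ℝ) (n₀ : ℤ) (bv wv M0 M1 db dw : ℤ → ℝ → ℝ) (q : ℝ) (R : ℤ → ℝ) (lad : ℕ → ℝ)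
      (G0 G1 : ℤ → ℝ → ℝ) (Inv : ℤ → ℝ → ℝ → Prop) (Tube : ℤ → ℝ → Prop) (n : ℤ) (B t₀ T : ℝ),
      q = Real.sqrt (1 + ε₀) → (∀ k : ℤ, R k = D * (1 + ε₀) ^ (2 * k)) →
      (∀ j : ℕ, lad j = εb * ((1 + ε₀) ^ (19 * (j - 2)))⁻¹) →
      (∀ (k : ℤ) (t : ℝ), G0 k t = (wv (k - 1) t) ^ 2 / q ^ 3 - (wv k t) ^ 2 - εb * bv k t * wv k t) →
      (∀ (k : ℤ) (t : ℝ), G1 k t = wv k t * (bv k t - bv (k + 1) t / q) + εb * (bv k t) ^ 2) →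
      (∀ (m : ℤ) (Bm t : ℝ), Inv m Bm t ↔
        (bv m t = Bm ∧ (∀ s ∈ Icc 0 t, bv m s ≤ Bm) ∧
        (0 ≤ wv m t ∧ wv m t ≤ F * εb * Bm ∧ M1 m t ≤ F * εb * Bm ∧ M0 m t ≤ 2 * Bm) ∧
        (n₀ ≤ m - 1 → 0 ≤ wv (m - 1) t ∧ q ^ 3 * Bm - 1 ≤ (wv (m - 1) t) ^ 2 ∧
          (wv (m - 1) t) ^ 2 ≤ q ^ 3 * Bm + 1 ∧ 9 / 20 ≤ bv (m - 1) t ∧ bv (m - 1) t ≤ 11 / 20 ∧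
          M0 (m - 1) t ≤ 5 * (bhi + 4) ^ 2 ∧ M1 (m - 1) t ≤ 5 * (bhi + 4) ^ 2) ∧
        (|bv (m + 1) t| ≤ εb ∧ |wv (m + 1) t| ≤ εb ∧ M0 (m + 1) t ≤ εb ∧ M1 (m + 1) t ≤ εb) ∧
        (∀ j : ℕ, 2 ≤ j → |bv (m + j) t| ≤ lad j ∧ |wv (m + j) t| ≤ lad j / 5 ∧
          M0 (m + j) t ≤ lad j ∧ M1 (m + j) t ≤ lad j) ∧
        (∀ j : ℕ, 1 ≤ j → ∀ s ∈ Icc 0 t, bv (m + j) s ≤ 1 / 2) ∧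
        (∀ k : ℤ, n₀ ≤ k → k ≤ m - 2 → ∃ te ∈ Icc 0 t,
          (-(2 / 5) ≤ bv k te ∧ bv k te ≤ 3 / 10 ∧ |wv k te| ≤ 1 / 200 ∧
            M0 k te ≤ 10 * (bhi + 4) ^ 2 ∧ M1 k te ≤ 10 * (bhi + 4) ^ 2) ∧
          ∀ s ∈ Icc te t, -(9 / 20) ≤ bv k s ∧ bv k s ≤ 7 / 20 ∧ |wv k s| ≤ 1 / 100 ∧
            M0 k s ≤ 10 * (bhi + 4) ^ 2 + 1 ∧ M1 k s ≤ 10 * (bhi + 4) ^ 2 + 1 ∧ |wv (k - 1) s| ≤ 1 / 100 ∧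
            -(1 / 2) ≤ bv (k + 1) s ∧ bv (k + 1) s ≤ 9 / 10))) →
      (∀ (m : ℤ) (t : ℝ), Tube m t ↔
        ((∀ k : ℤ, k ≤ m + 1 → |bv k t| ≤ 2 * (bhi + 3) ∧ |wv k t| ≤ 2 * (bhi + 3) ∧
          M0 k t ≤ 20 * (bhi + 4) ^ 2 ∧ M1 k t ≤ 20 * (bhi + 4) ^ 2) ∧
        (∀ j : ℕ, 2 ≤ j → |bv (m + j) t| ≤ lad j ∧ |wv (m + j) t| ≤ lad j ∧
          M0 (m + j) t ≤ lad j ∧ M1 (m + j) t ≤ lad j))) →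
      -- regime
      0 < ε₀ → ε₀ ≤ 1 / 20 → 0 < D → 1 / 2 ≤ θ → θ ≤ 1 → 0 ≤ η → 0 < εb → εb ≤ 1 / 10 ^ 6 →
      10 ^ 4 + 40 - 5 * Real.log εb ≤ blo → 10 ^ 9 * (bhi + 4) ^ 4 ≤ F →
      η * (10 ^ 9 * (bhi + 4) ^ 4 * (F + 1)) ≤ 1 → εb * (10 ^ 9 * (F + 1) ^ 2 * (bhi + 4) ^ 3) ≤ 1 →
      10 ^ 3 + 20 * Real.log (bhi + 5) + Real.log (F + 2) ≤ -Real.log εb →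
      -- the critical system with memory errors on [0, T]
      n₀ ≤ n → 0 ≤ t₀ → t₀ < T → blo ≤ B → B ≤ bhi →
      (∀ k : ℤ, k < n₀ → ∀ t ∈ Icc 0 T, bv k t = 0 ∧ wv k t = 0 ∧ M0 k t = 0 ∧ M1 k t = 0) →
      (∀ k : ℤ, ContinuousOn (bv k) (Icc 0 T) ∧ ContinuousOn (wv k) (Icc 0 T) ∧
        ContinuousOn (M0 k) (Icc 0 T) ∧ ContinuousOn (M1 k) (Icc 0 T)) →
      (∀ k : ℤ, ContinuousOn (db k) (Icc 0 T) ∧ ContinuousOn (dw k) (Icc 0 T) ∧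
        ∀ t ∈ Ioo 0 T, HasDerivAt (bv k) (db k t) t ∧
          |db k t - R k * (-(bv k t) + G0 k t)| ≤ η * R k * M0 k t ∧
          HasDerivAt (wv k) (dw k t) t ∧ |dw k t - R k * (-(wv k t) + G1 k t)| ≤ η * R k * M1 k t) →
      (∀ k : ℤ, ∀ t ∈ Icc 0 T, |bv k t| ≤ M0 k t ∧ |wv k t| ≤ M1 k t ∧ 0 ≤ M0 k t ∧ 0 ≤ M1 k t) →
      (∀ k : ℤ, ∀ t₁ ∈ Icc 0 T, ∀ t₂ ∈ Icc t₁ T,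
        M0 k t₂ ≤ M0 k t₁ * Real.exp (-(θ * R k * (t₂ - t₁))) +
          R k * ∫ u in t₁..t₂, Real.exp (-(θ * R k * (t₂ - u))) * |G0 k u| ∧
        M1 k t₂ ≤ M1 k t₁ * Real.exp (-(θ * R k * (t₂ - t₁))) +
          R k * ∫ u in t₁..t₂, Real.exp (-(θ * R k * (t₂ - u))) * |G1 k u|) →
      -- the a-priori far tail above the front, and the hand-off invariant at t₀
      (∃ J : ℕ, ∀ j : ℕ, J ≤ j → ∀ t ∈ Icc 0 T,
        |bv (n + j) t| ≤ lad j ∧ |wv (n + j) t| ≤ lad j / 5 ∧ M0 (n + j) t ≤ lad j ∧ M1 (n + j) t ≤ lad j) →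
      Inv n B t₀ →
      ∀ (Pre : ℝ → Prop) (t' : ℝ),
      (∀ s : ℝ, Pre s ↔
        ((B * Real.exp (-(R n * (s - t₀))) - 3 / 2 ≤ bv n s ∧ bv n s ≤ B * Real.exp (-(R n * (s - t₀))) + 5 / 2 ∧
          0 ≤ wv n s ∧ M0 n s ≤ 6 * (B + 3) ∧
          M1 n s ≤ F * εb * B + 2 * wv n s + 2 * εb * (B + 3) ^ 2 * (R n * (s - t₀))) ∧
        (n₀ ≤ n - 1 → -(1 / 100) ≤ wv (n - 1) s ∧ (wv (n - 1) s) ^ 2 ≤ q ^ 3 * B + 2 ∧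
          -(2 / 5) ≤ bv (n - 1) s ∧ bv (n - 1) s ≤ 17 / 20 ∧
          (t₀ + 2 * (100 + 4 * Real.log (bhi + 5)) / (B * R n) ≤ s → |wv (n - 1) s| ≤ 1 / 200 ∧ bv (n - 1) s ≤ 3 / 10) ∧
          M0 (n - 1) s ≤ 6 * (bhi + 4) ^ 2 ∧ M1 (n - 1) s ≤ 6 * (bhi + 4) ^ 2 ∧
          (1 + ε₀) ^ (-(2 : ℤ)) * R n * ∫ u in t₀..s, (wv (n - 1) u) ^ 2 ≤ 9 / 10) ∧
        (|bv (n + 1) s| ≤ εb + q / 100 + 1 / 10 ^ 3 ∧ |wv (n + 1) s| ≤ 11 / 10 * εb ∧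
          M0 (n + 1) s ≤ εb + (B + 3) / 40 ∧ M1 (n + 1) s ≤ 4 * εb) ∧
        (∀ j : ℕ, 2 ≤ j → |bv (n + j) s| ≤ lad j ∧ |wv (n + j) s| ≤ lad j / 5 ∧
          M0 (n + j) s ≤ lad j ∧ M1 (n + j) s ≤ lad j) ∧
        (∀ k : ℤ, n₀ ≤ k → k ≤ n - 2 → -(9 / 20) ≤ bv k s ∧ bv k s ≤ 7 / 20 ∧ |wv k s| ≤ 1 / 100 ∧
          M0 k s ≤ 10 * (bhi + 4) ^ 2 + 1 ∧ M1 k s ≤ 10 * (bhi + 4) ^ 2 + 1))) →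
      t₀ < t' → t' ≤ T → t' ≤ t₀ + 3 / R n →
      (∀ s ∈ Icc t₀ t', (wv n s) ^ 2 ≤ bv n s / 100) →
      (∀ s ∈ Icc t₀ t', Pre s) ∧ (∀ s ∈ Ioc t₀ t', 0 < wv n s) ∧
      (R n * ∫ u in t₀..t', (wv n u) ^ 2 ≤ 1 / 100) ∧
      B * (1 - Real.exp (-(R n * (t' - t₀)))) ≤
        max 0 (Real.log (6 / 10 * Real.sqrt (B + 4) / (εb * B))) + 6 * (R n * (t' - t₀) + 1) + 2 ∧
      (bv n t' / 100 ≤ (wv n t') ^ 2 → bv n t' ≤ B + Real.log (10 * (F + 2) * εb * B) + 6 * (R n * (t' - t₀) + 1))) →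
    (∀ (ε₀ D εb θ η F blo bhi : ℝ) (n₀ : ℤ) (bv wv M0 M1 db dw : ℤ → ℝ → ℝ) (q : ℝ) (R : ℤ → ℝ) (lad : ℕ → ℝ)
      (G0 G1 : ℤ → ℝ → ℝ) (Inv : ℤ → ℝ → ℝ → Prop) (Tube : ℤ → ℝ → Prop) (n : ℤ) (B t₀ T : ℝ),
      q = Real.sqrt (1 + ε₀) → (∀ k : ℤ, R k = D * (1 + ε₀) ^ (2 * k)) →
      (∀ j : ℕ, lad j = εb * ((1 + ε₀) ^ (19 * (j - 2)))⁻¹) →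
      (∀ (k : ℤ) (t : ℝ), G0 k t = (wv (k - 1) t) ^ 2 / q ^ 3 - (wv k t) ^ 2 - εb * bv k t * wv k t) →
      (∀ (k : ℤ) (t : ℝ), G1 k t = wv k t * (bv k t - bv (k + 1) t / q) + εb * (bv k t) ^ 2) →
      (∀ (m : ℤ) (Bm t : ℝ), Inv m Bm t ↔
        (bv m t = Bm ∧ (∀ s ∈ Icc 0 t, bv m s ≤ Bm) ∧
        (0 ≤ wv m t ∧ wv m t ≤ F * εb * Bm ∧ M1 m t ≤ F * εb * Bm ∧ M0 m t ≤ 2 * Bm) ∧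
        (n₀ ≤ m - 1 → 0 ≤ wv (m - 1) t ∧ q ^ 3 * Bm - 1 ≤ (wv (m - 1) t) ^ 2 ∧
          (wv (m - 1) t) ^ 2 ≤ q ^ 3 * Bm + 1 ∧ 9 / 20 ≤ bv (m - 1) t ∧ bv (m - 1) t ≤ 11 / 20 ∧
          M0 (m - 1) t ≤ 5 * (bhi + 4) ^ 2 ∧ M1 (m - 1) t ≤ 5 * (bhi + 4) ^ 2) ∧
        (|bv (m + 1) t| ≤ εb ∧ |wv (m + 1) t| ≤ εb ∧ M0 (m + 1) t ≤ εb ∧ M1 (m + 1) t ≤ εb) ∧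
        (∀ j : ℕ, 2 ≤ j → |bv (m + j) t| ≤ lad j ∧ |wv (m + j) t| ≤ lad j / 5 ∧
          M0 (m + j) t ≤ lad j ∧ M1 (m + j) t ≤ lad j) ∧
        (∀ j : ℕ, 1 ≤ j → ∀ s ∈ Icc 0 t, bv (m + j) s ≤ 1 / 2) ∧
        (∀ k : ℤ, n₀ ≤ k → k ≤ m - 2 → ∃ te ∈ Icc 0 t,
          (-(2 / 5) ≤ bv k te ∧ bv k te ≤ 3 / 10 ∧ |wv k te| ≤ 1 / 200 ∧
            M0 k te ≤ 10 * (bhi + 4) ^ 2 ∧ M1 k te ≤ 10 * (bhi + 4) ^ 2) ∧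
          ∀ s ∈ Icc te t, -(9 / 20) ≤ bv k s ∧ bv k s ≤ 7 / 20 ∧ |wv k s| ≤ 1 / 100 ∧
            M0 k s ≤ 10 * (bhi + 4) ^ 2 + 1 ∧ M1 k s ≤ 10 * (bhi + 4) ^ 2 + 1 ∧ |wv (k - 1) s| ≤ 1 / 100 ∧
            -(1 / 2) ≤ bv (k + 1) s ∧ bv (k + 1) s ≤ 9 / 10))) →
      (∀ (m : ℤ) (t : ℝ), Tube m t ↔
        ((∀ k : ℤ, k ≤ m + 1 → |bv k t| ≤ 2 * (bhi + 3) ∧ |wv k t| ≤ 2 * (bhi + 3) ∧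
          M0 k t ≤ 20 * (bhi + 4) ^ 2 ∧ M1 k t ≤ 20 * (bhi + 4) ^ 2) ∧
        (∀ j : ℕ, 2 ≤ j → |bv (m + j) t| ≤ lad j ∧ |wv (m + j) t| ≤ lad j ∧
          M0 (m + j) t ≤ lad j ∧ M1 (m + j) t ≤ lad j))) →
      -- regime
      0 < ε₀ → ε₀ ≤ 1 / 20 → 0 < D → 1 / 2 ≤ θ → θ ≤ 1 → 0 ≤ η → 0 < εb → εb ≤ 1 / 10 ^ 6 →
      10 ^ 4 + 40 - 5 * Real.log εb ≤ blo → 10 ^ 9 * (bhi + 4) ^ 4 ≤ F →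
      η * (10 ^ 9 * (bhi + 4) ^ 4 * (F + 1)) ≤ 1 → εb * (10 ^ 9 * (F + 1) ^ 2 * (bhi + 4) ^ 3) ≤ 1 →
      10 ^ 3 + 20 * Real.log (bhi + 5) + Real.log (F + 2) ≤ -Real.log εb →
      -- the critical system with memory errors on [0, T]
      n₀ ≤ n → 0 ≤ t₀ → t₀ < T → blo ≤ B → B ≤ bhi →
      (∀ k : ℤ, k < n₀ → ∀ t ∈ Icc 0 T, bv k t = 0 ∧ wv k t = 0 ∧ M0 k t = 0 ∧ M1 k t = 0) →
      (∀ k : ℤ, ContinuousOn (bv k) (Icc 0 T) ∧ ContinuousOn (wv k) (Icc 0 T) ∧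
        ContinuousOn (M0 k) (Icc 0 T) ∧ ContinuousOn (M1 k) (Icc 0 T)) →
      (∀ k : ℤ, ContinuousOn (db k) (Icc 0 T) ∧ ContinuousOn (dw k) (Icc 0 T) ∧
        ∀ t ∈ Ioo 0 T, HasDerivAt (bv k) (db k t) t ∧
          |db k t - R k * (-(bv k t) + G0 k t)| ≤ η * R k * M0 k t ∧
          HasDerivAt (wv k) (dw k t) t ∧ |dw k t - R k * (-(wv k t) + G1 k t)| ≤ η * R k * M1 k t) →
      (∀ k : ℤ, ∀ t ∈ Icc 0 T, |bv k t| ≤ M0 k t ∧ |wv k t| ≤ M1 k t ∧ 0 ≤ M0 k t ∧ 0 ≤ M1 k t) →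
      (∀ k : ℤ, ∀ t₁ ∈ Icc 0 T, ∀ t₂ ∈ Icc t₁ T,
        M0 k t₂ ≤ M0 k t₁ * Real.exp (-(θ * R k * (t₂ - t₁))) +
          R k * ∫ u in t₁..t₂, Real.exp (-(θ * R k * (t₂ - u))) * |G0 k u| ∧
        M1 k t₂ ≤ M1 k t₁ * Real.exp (-(θ * R k * (t₂ - t₁))) +
          R k * ∫ u in t₁..t₂, Real.exp (-(θ * R k * (t₂ - u))) * |G1 k u|) →
      -- the a-priori far tail above the front, and the hand-off invariant at t₀
      (∃ J : ℕ, ∀ j : ℕ, J ≤ j → ∀ t ∈ Icc 0 T,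
        |bv (n + j) t| ≤ lad j ∧ |wv (n + j) t| ≤ lad j / 5 ∧ M0 (n + j) t ≤ lad j ∧ M1 (n + j) t ≤ lad j) →
      Inv n B t₀ →
      ∀ (Pre Pul : ℝ → Prop) (tι t'' : ℝ),
      (∀ s : ℝ, Pre s ↔
        ((B * Real.exp (-(R n * (s - t₀))) - 3 / 2 ≤ bv n s ∧ bv n s ≤ B * Real.exp (-(R n * (s - t₀))) + 5 / 2 ∧
          0 ≤ wv n s ∧ M0 n s ≤ 6 * (B + 3) ∧
          M1 n s ≤ F * εb * B + 2 * wv n s + 2 * εb * (B + 3) ^ 2 * (R n * (s - t₀))) ∧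
        (n₀ ≤ n - 1 → -(1 / 100) ≤ wv (n - 1) s ∧ (wv (n - 1) s) ^ 2 ≤ q ^ 3 * B + 2 ∧
          -(2 / 5) ≤ bv (n - 1) s ∧ bv (n - 1) s ≤ 17 / 20 ∧
          (t₀ + 2 * (100 + 4 * Real.log (bhi + 5)) / (B * R n) ≤ s → |wv (n - 1) s| ≤ 1 / 200 ∧ bv (n - 1) s ≤ 3 / 10) ∧
          M0 (n - 1) s ≤ 6 * (bhi + 4) ^ 2 ∧ M1 (n - 1) s ≤ 6 * (bhi + 4) ^ 2 ∧
          (1 + ε₀) ^ (-(2 : ℤ)) * R n * ∫ u in t₀..s, (wv (n - 1) u) ^ 2 ≤ 9 / 10) ∧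
        (|bv (n + 1) s| ≤ εb + q / 100 + 1 / 10 ^ 3 ∧ |wv (n + 1) s| ≤ 11 / 10 * εb ∧
          M0 (n + 1) s ≤ εb + (B + 3) / 40 ∧ M1 (n + 1) s ≤ 4 * εb) ∧
        (∀ j : ℕ, 2 ≤ j → |bv (n + j) s| ≤ lad j ∧ |wv (n + j) s| ≤ lad j / 5 ∧
          M0 (n + j) s ≤ lad j ∧ M1 (n + j) s ≤ lad j) ∧
        (∀ k : ℤ, n₀ ≤ k → k ≤ n - 2 → -(9 / 20) ≤ bv k s ∧ bv k s ≤ 7 / 20 ∧ |wv k s| ≤ 1 / 100 ∧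
          M0 k s ≤ 10 * (bhi + 4) ^ 2 + 1 ∧ M1 k s ≤ 10 * (bhi + 4) ^ 2 + 1))) →
      (∀ s : ℝ, Pul s ↔
        ((-(1 / 2) ≤ bv n s ∧ bv n s ≤ bv n tι + 1 / 100 ∧ |wv n s| ≤ bv n tι + 1 / 100 ∧
          -(q / 50) ≤ bv (n + 1) s ∧ bv (n + 1) s ≤ q * (bv n tι + 1 / 100) ∧
          M0 n s ≤ 3 * (bhi + 4) ^ 2 ∧ M1 n s ≤ 5 * (bhi + 4) ^ 2 ∧ M0 (n + 1) s ≤ 3 / 2 * B ∧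
          |wv (n + 1) s| ≤ 1 / 10 ^ 3 ∧ M1 (n + 1) s ≤ 1) ∧
        (n₀ ≤ n - 1 → |wv (n - 1) s| ≤ 1 / 200 ∧ -(2 / 5) ≤ bv (n - 1) s ∧ bv (n - 1) s ≤ 3 / 10 ∧
          M0 (n - 1) s ≤ 6 * (bhi + 4) ^ 2 ∧ M1 (n - 1) s ≤ 6 * (bhi + 4) ^ 2 ∧
          (1 + ε₀) ^ (-(2 : ℤ)) * R n * ∫ u in t₀..s, (wv (n - 1) u) ^ 2 ≤ 9 / 10) ∧
        (∀ j : ℕ, 2 ≤ j → |bv (n + j) s| ≤ lad j ∧ |wv (n + j) s| ≤ lad j / 5 ∧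
          M0 (n + j) s ≤ lad j ∧ M1 (n + j) s ≤ lad j) ∧
        (∀ k : ℤ, n₀ ≤ k → k ≤ n - 2 → -(9 / 20) ≤ bv k s ∧ bv k s ≤ 7 / 20 ∧ |wv k s| ≤ 1 / 100 ∧
          M0 k s ≤ 10 * (bhi + 4) ^ 2 + 1 ∧ M1 k s ≤ 10 * (bhi + 4) ^ 2 + 1))) →
      t₀ < tι → tι ≤ t₀ + 3 / R n → t₀ + 2 * (100 + 4 * Real.log (bhi + 5)) / (B * R n) ≤ tι → 10 ^ 4 ≤ bv n tι →
      (∀ s ∈ Icc t₀ tι, Pre s) → (∀ s ∈ Ioc t₀ tι, 0 < wv n s) → (R n * ∫ u in t₀..tι, (wv n u) ^ 2 ≤ 1 / 100) →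
      (∀ s ∈ Icc t₀ tι, (wv n s) ^ 2 ≤ bv n s / 100) → (wv n tι) ^ 2 = bv n tι / 100 →
      bv n tι ≤ B + Real.log (10 * (F + 2) * εb * B) + 6 * (R n * (tι - t₀) + 1) →
      B * (1 - Real.exp (-(R n * (tι - t₀)))) ≤
        max 0 (Real.log (6 / 10 * Real.sqrt (B + 4) / (εb * B))) + 6 * (R n * (tι - t₀) + 1) + 2 →
      tι < t'' → t'' ≤ T → t'' ≤ tι + (5 * Real.log (bv n tι) + 20) / bv n tι / R n →
      ∀ s ∈ Icc tι t'', Pul s) →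
    (∀ (ε₀ D εb θ η F blo bhi : ℝ) (n₀ : ℤ) (bv wv M0 M1 db dw : ℤ → ℝ → ℝ) (q : ℝ) (R : ℤ → ℝ) (lad : ℕ → ℝ)
      (G0 G1 : ℤ → ℝ → ℝ) (Inv : ℤ → ℝ → ℝ → Prop) (Tube : ℤ → ℝ → Prop) (n : ℤ) (B t₀ T : ℝ),
      q = Real.sqrt (1 + ε₀) → (∀ k : ℤ, R k = D * (1 + ε₀) ^ (2 * k)) →
      (∀ j : ℕ, lad j = εb * ((1 + ε₀) ^ (19 * (j - 2)))⁻¹) →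
      (∀ (k : ℤ) (t : ℝ), G0 k t = (wv (k - 1) t) ^ 2 / q ^ 3 - (wv k t) ^ 2 - εb * bv k t * wv k t) →
      (∀ (k : ℤ) (t : ℝ), G1 k t = wv k t * (bv k t - bv (k + 1) t / q) + εb * (bv k t) ^ 2) →
      (∀ (m : ℤ) (Bm t : ℝ), Inv m Bm t ↔
        (bv m t = Bm ∧ (∀ s ∈ Icc 0 t, bv m s ≤ Bm) ∧
        (0 ≤ wv m t ∧ wv m t ≤ F * εb * Bm ∧ M1 m t ≤ F * εb * Bm ∧ M0 m t ≤ 2 * Bm) ∧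
        (n₀ ≤ m - 1 → 0 ≤ wv (m - 1) t ∧ q ^ 3 * Bm - 1 ≤ (wv (m - 1) t) ^ 2 ∧
          (wv (m - 1) t) ^ 2 ≤ q ^ 3 * Bm + 1 ∧ 9 / 20 ≤ bv (m - 1) t ∧ bv (m - 1) t ≤ 11 / 20 ∧
          M0 (m - 1) t ≤ 5 * (bhi + 4) ^ 2 ∧ M1 (m - 1) t ≤ 5 * (bhi + 4) ^ 2) ∧
        (|bv (m + 1) t| ≤ εb ∧ |wv (m + 1) t| ≤ εb ∧ M0 (m + 1) t ≤ εb ∧ M1 (m + 1) t ≤ εb) ∧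
        (∀ j : ℕ, 2 ≤ j → |bv (m + j) t| ≤ lad j ∧ |wv (m + j) t| ≤ lad j / 5 ∧
          M0 (m + j) t ≤ lad j ∧ M1 (m + j) t ≤ lad j) ∧
        (∀ j : ℕ, 1 ≤ j → ∀ s ∈ Icc 0 t, bv (m + j) s ≤ 1 / 2) ∧
        (∀ k : ℤ, n₀ ≤ k → k ≤ m - 2 → ∃ te ∈ Icc 0 t,
          (-(2 / 5) ≤ bv k te ∧ bv k te ≤ 3 / 10 ∧ |wv k te| ≤ 1 / 200 ∧
            M0 k te ≤ 10 * (bhi + 4) ^ 2 ∧ M1 k te ≤ 10 * (bhi + 4) ^ 2) ∧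
          ∀ s ∈ Icc te t, -(9 / 20) ≤ bv k s ∧ bv k s ≤ 7 / 20 ∧ |wv k s| ≤ 1 / 100 ∧
            M0 k s ≤ 10 * (bhi + 4) ^ 2 + 1 ∧ M1 k s ≤ 10 * (bhi + 4) ^ 2 + 1 ∧ |wv (k - 1) s| ≤ 1 / 100 ∧
            -(1 / 2) ≤ bv (k + 1) s ∧ bv (k + 1) s ≤ 9 / 10))) →
      (∀ (m : ℤ) (t : ℝ), Tube m t ↔
        ((∀ k : ℤ, k ≤ m + 1 → |bv k t| ≤ 2 * (bhi + 3) ∧ |wv k t| ≤ 2 * (bhi + 3) ∧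
          M0 k t ≤ 20 * (bhi + 4) ^ 2 ∧ M1 k t ≤ 20 * (bhi + 4) ^ 2) ∧
        (∀ j : ℕ, 2 ≤ j → |bv (m + j) t| ≤ lad j ∧ |wv (m + j) t| ≤ lad j ∧
          M0 (m + j) t ≤ lad j ∧ M1 (m + j) t ≤ lad j))) →
      -- regime
      0 < ε₀ → ε₀ ≤ 1 / 20 → 0 < D → 1 / 2 ≤ θ → θ ≤ 1 → 0 ≤ η → 0 < εb → εb ≤ 1 / 10 ^ 6 →
      10 ^ 4 + 40 - 5 * Real.log εb ≤ blo → 10 ^ 9 * (bhi + 4) ^ 4 ≤ F →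
      η * (10 ^ 9 * (bhi + 4) ^ 4 * (F + 1)) ≤ 1 → εb * (10 ^ 9 * (F + 1) ^ 2 * (bhi + 4) ^ 3) ≤ 1 →
      10 ^ 3 + 20 * Real.log (bhi + 5) + Real.log (F + 2) ≤ -Real.log εb →
      -- the critical system with memory errors on [0, T]
      n₀ ≤ n → 0 ≤ t₀ → t₀ < T → blo ≤ B → B ≤ bhi →
      (∀ k : ℤ, k < n₀ → ∀ t ∈ Icc 0 T, bv k t = 0 ∧ wv k t = 0 ∧ M0 k t = 0 ∧ M1 k t = 0) →
      (∀ k : ℤ, ContinuousOn (bv k) (Icc 0 T) ∧ ContinuousOn (wv k) (Icc 0 T) ∧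
        ContinuousOn (M0 k) (Icc 0 T) ∧ ContinuousOn (M1 k) (Icc 0 T)) →
      (∀ k : ℤ, ContinuousOn (db k) (Icc 0 T) ∧ ContinuousOn (dw k) (Icc 0 T) ∧
        ∀ t ∈ Ioo 0 T, HasDerivAt (bv k) (db k t) t ∧
          |db k t - R k * (-(bv k t) + G0 k t)| ≤ η * R k * M0 k t ∧
          HasDerivAt (wv k) (dw k t) t ∧ |dw k t - R k * (-(wv k t) + G1 k t)| ≤ η * R k * M1 k t) →
      (∀ k : ℤ, ∀ t ∈ Icc 0 T, |bv k t| ≤ M0 k t ∧ |wv k t| ≤ M1 k t ∧ 0 ≤ M0 k t ∧ 0 ≤ M1 k t) →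
      (∀ k : ℤ, ∀ t₁ ∈ Icc 0 T, ∀ t₂ ∈ Icc t₁ T,
        M0 k t₂ ≤ M0 k t₁ * Real.exp (-(θ * R k * (t₂ - t₁))) +
          R k * ∫ u in t₁..t₂, Real.exp (-(θ * R k * (t₂ - u))) * |G0 k u| ∧
        M1 k t₂ ≤ M1 k t₁ * Real.exp (-(θ * R k * (t₂ - t₁))) +
          R k * ∫ u in t₁..t₂, Real.exp (-(θ * R k * (t₂ - u))) * |G1 k u|) →
      -- the a-priori far tail above the front, and the hand-off invariant at t₀
      (∃ J : ℕ, ∀ j : ℕ, J ≤ j → ∀ t ∈ Icc 0 T,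
        |bv (n + j) t| ≤ lad j ∧ |wv (n + j) t| ≤ lad j / 5 ∧ M0 (n + j) t ≤ lad j ∧ M1 (n + j) t ≤ lad j) →
      Inv n B t₀ →
      ∀ (Pre Pul : ℝ → Prop) (tι : ℝ),
      (∀ s : ℝ, Pre s ↔
        ((B * Real.exp (-(R n * (s - t₀))) - 3 / 2 ≤ bv n s ∧ bv n s ≤ B * Real.exp (-(R n * (s - t₀))) + 5 / 2 ∧
          0 ≤ wv n s ∧ M0 n s ≤ 6 * (B + 3) ∧
          M1 n s ≤ F * εb * B + 2 * wv n s + 2 * εb * (B + 3) ^ 2 * (R n * (s - t₀))) ∧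
        (n₀ ≤ n - 1 → -(1 / 100) ≤ wv (n - 1) s ∧ (wv (n - 1) s) ^ 2 ≤ q ^ 3 * B + 2 ∧
          -(2 / 5) ≤ bv (n - 1) s ∧ bv (n - 1) s ≤ 17 / 20 ∧
          (t₀ + 2 * (100 + 4 * Real.log (bhi + 5)) / (B * R n) ≤ s → |wv (n - 1) s| ≤ 1 / 200 ∧ bv (n - 1) s ≤ 3 / 10) ∧
          M0 (n - 1) s ≤ 6 * (bhi + 4) ^ 2 ∧ M1 (n - 1) s ≤ 6 * (bhi + 4) ^ 2 ∧
          (1 + ε₀) ^ (-(2 : ℤ)) * R n * ∫ u in t₀..s, (wv (n - 1) u) ^ 2 ≤ 9 / 10) ∧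
        (|bv (n + 1) s| ≤ εb + q / 100 + 1 / 10 ^ 3 ∧ |wv (n + 1) s| ≤ 11 / 10 * εb ∧
          M0 (n + 1) s ≤ εb + (B + 3) / 40 ∧ M1 (n + 1) s ≤ 4 * εb) ∧
        (∀ j : ℕ, 2 ≤ j → |bv (n + j) s| ≤ lad j ∧ |wv (n + j) s| ≤ lad j / 5 ∧
          M0 (n + j) s ≤ lad j ∧ M1 (n + j) s ≤ lad j) ∧
        (∀ k : ℤ, n₀ ≤ k → k ≤ n - 2 → -(9 / 20) ≤ bv k s ∧ bv k s ≤ 7 / 20 ∧ |wv k s| ≤ 1 / 100 ∧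
          M0 k s ≤ 10 * (bhi + 4) ^ 2 + 1 ∧ M1 k s ≤ 10 * (bhi + 4) ^ 2 + 1))) →
      (∀ s : ℝ, Pul s ↔
        ((-(1 / 2) ≤ bv n s ∧ bv n s ≤ bv n tι + 1 / 100 ∧ |wv n s| ≤ bv n tι + 1 / 100 ∧
          -(q / 50) ≤ bv (n + 1) s ∧ bv (n + 1) s ≤ q * (bv n tι + 1 / 100) ∧
          M0 n s ≤ 3 * (bhi + 4) ^ 2 ∧ M1 n s ≤ 5 * (bhi + 4) ^ 2 ∧ M0 (n + 1) s ≤ 3 / 2 * B ∧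
          |wv (n + 1) s| ≤ 1 / 10 ^ 3 ∧ M1 (n + 1) s ≤ 1) ∧
        (n₀ ≤ n - 1 → |wv (n - 1) s| ≤ 1 / 200 ∧ -(2 / 5) ≤ bv (n - 1) s ∧ bv (n - 1) s ≤ 3 / 10 ∧
          M0 (n - 1) s ≤ 6 * (bhi + 4) ^ 2 ∧ M1 (n - 1) s ≤ 6 * (bhi + 4) ^ 2 ∧
          (1 + ε₀) ^ (-(2 : ℤ)) * R n * ∫ u in t₀..s, (wv (n - 1) u) ^ 2 ≤ 9 / 10) ∧
        (∀ j : ℕ, 2 ≤ j → |bv (n + j) s| ≤ lad j ∧ |wv (n + j) s| ≤ lad j / 5 ∧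
          M0 (n + j) s ≤ lad j ∧ M1 (n + j) s ≤ lad j) ∧
        (∀ k : ℤ, n₀ ≤ k → k ≤ n - 2 → -(9 / 20) ≤ bv k s ∧ bv k s ≤ 7 / 20 ∧ |wv k s| ≤ 1 / 100 ∧
          M0 k s ≤ 10 * (bhi + 4) ^ 2 + 1 ∧ M1 k s ≤ 10 * (bhi + 4) ^ 2 + 1))) →
      t₀ < tι → tι ≤ t₀ + 3 / R n → t₀ + 2 * (100 + 4 * Real.log (bhi + 5)) / (B * R n) ≤ tι → 10 ^ 4 ≤ bv n tι →
      (∀ s ∈ Icc t₀ tι, Pre s) → (∀ s ∈ Ioc t₀ tι, 0 < wv n s) → (R n * ∫ u in t₀..tι, (wv n u) ^ 2 ≤ 1 / 100) →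
      (∀ s ∈ Icc t₀ tι, (wv n s) ^ 2 ≤ bv n s / 100) → (wv n tι) ^ 2 = bv n tι / 100 →
      bv n tι ≤ B + Real.log (10 * (F + 2) * εb * B) + 6 * (R n * (tι - t₀) + 1) →
      B * (1 - Real.exp (-(R n * (tι - t₀)))) ≤
        max 0 (Real.log (6 / 10 * Real.sqrt (B + 4) / (εb * B))) + 6 * (R n * (tι - t₀) + 1) + 2 →
      tι + (5 * Real.log (bv n tι) + 20) / bv n tι / R n ≤ T →
      (∀ s ∈ Icc tι (tι + (5 * Real.log (bv n tι) + 20) / bv n tι / R n), Pul s) →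
      (∃ t₁ ∈ Ioo t₀ T, t₁ ≤ t₀ + 4 / R n ∧ ∃ B' : ℝ, Inv (n + 1) B' t₁ ∧
        q * (B + Real.log εb - 6 * Real.log (B + 2) - 58) ≤ B' ∧
        B' ≤ q * (B + Real.log (10 * (F + 2) * εb * B) + 25) ∧
        (∀ t ∈ Icc t₀ t₁, Tube n t ∧ bv n t ≤ B + 3) ∧
        (∃ tc ∈ Ioo t₀ t₁, (∀ s ∈ Ico t₀ tc, bv (n + 1) s < 1) ∧ bv (n + 1) tc = 1 ∧
          ∃ δ : ℝ, 0 < δ ∧ tc + δ ≤ t₁ ∧ ∀ s ∈ Ioc tc (tc + δ), 1 < bv (n + 1) s))) →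
    ∀ (ε₀ D εb θ η F blo bhi : ℝ) (n₀ : ℤ) (bv wv M0 M1 db dw : ℤ → ℝ → ℝ) (q : ℝ) (R : ℤ → ℝ) (lad : ℕ → ℝ)
      (G0 G1 : ℤ → ℝ → ℝ) (Inv : ℤ → ℝ → ℝ → Prop) (Tube : ℤ → ℝ → Prop) (n : ℤ) (B t₀ T : ℝ),
      q = Real.sqrt (1 + ε₀) → (∀ k : ℤ, R k = D * (1 + ε₀) ^ (2 * k)) →
      (∀ j : ℕ, lad j = εb * ((1 + ε₀) ^ (19 * (j - 2)))⁻¹) →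
      (∀ (k : ℤ) (t : ℝ), G0 k t = (wv (k - 1) t) ^ 2 / q ^ 3 - (wv k t) ^ 2 - εb * bv k t * wv k t) →
      (∀ (k : ℤ) (t : ℝ), G1 k t = wv k t * (bv k t - bv (k + 1) t / q) + εb * (bv k t) ^ 2) →
      (∀ (m : ℤ) (Bm t : ℝ), Inv m Bm t ↔
        (bv m t = Bm ∧ (∀ s ∈ Icc 0 t, bv m s ≤ Bm) ∧
        (0 ≤ wv m t ∧ wv m t ≤ F * εb * Bm ∧ M1 m t ≤ F * εb * Bm ∧ M0 m t ≤ 2 * Bm) ∧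
        (n₀ ≤ m - 1 → 0 ≤ wv (m - 1) t ∧ q ^ 3 * Bm - 1 ≤ (wv (m - 1) t) ^ 2 ∧
          (wv (m - 1) t) ^ 2 ≤ q ^ 3 * Bm + 1 ∧ 9 / 20 ≤ bv (m - 1) t ∧ bv (m - 1) t ≤ 11 / 20 ∧
          M0 (m - 1) t ≤ 5 * (bhi + 4) ^ 2 ∧ M1 (m - 1) t ≤ 5 * (bhi + 4) ^ 2) ∧
        (|bv (m + 1) t| ≤ εb ∧ |wv (m + 1) t| ≤ εb ∧ M0 (m + 1) t ≤ εb ∧ M1 (m + 1) t ≤ εb) ∧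
        (∀ j : ℕ, 2 ≤ j → |bv (m + j) t| ≤ lad j ∧ |wv (m + j) t| ≤ lad j / 5 ∧
          M0 (m + j) t ≤ lad j ∧ M1 (m + j) t ≤ lad j) ∧
        (∀ j : ℕ, 1 ≤ j → ∀ s ∈ Icc 0 t, bv (m + j) s ≤ 1 / 2) ∧
        (∀ k : ℤ, n₀ ≤ k → k ≤ m - 2 → ∃ te ∈ Icc 0 t,
          (-(2 / 5) ≤ bv k te ∧ bv k te ≤ 3 / 10 ∧ |wv k te| ≤ 1 / 200 ∧
            M0 k te ≤ 10 * (bhi + 4) ^ 2 ∧ M1 k te ≤ 10 * (bhi + 4) ^ 2) ∧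
          ∀ s ∈ Icc te t, -(9 / 20) ≤ bv k s ∧ bv k s ≤ 7 / 20 ∧ |wv k s| ≤ 1 / 100 ∧
            M0 k s ≤ 10 * (bhi + 4) ^ 2 + 1 ∧ M1 k s ≤ 10 * (bhi + 4) ^ 2 + 1 ∧ |wv (k - 1) s| ≤ 1 / 100 ∧
            -(1 / 2) ≤ bv (k + 1) s ∧ bv (k + 1) s ≤ 9 / 10))) →
      (∀ (m : ℤ) (t : ℝ), Tube m t ↔
        ((∀ k : ℤ, k ≤ m + 1 → |bv k t| ≤ 2 * (bhi + 3) ∧ |wv k t| ≤ 2 * (bhi + 3) ∧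
          M0 k t ≤ 20 * (bhi + 4) ^ 2 ∧ M1 k t ≤ 20 * (bhi + 4) ^ 2) ∧
        (∀ j : ℕ, 2 ≤ j → |bv (m + j) t| ≤ lad j ∧ |wv (m + j) t| ≤ lad j ∧
          M0 (m + j) t ≤ lad j ∧ M1 (m + j) t ≤ lad j))) →
      -- regime
      0 < ε₀ → ε₀ ≤ 1 / 20 → 0 < D → 1 / 2 ≤ θ → θ ≤ 1 → 0 ≤ η → 0 < εb → εb ≤ 1 / 10 ^ 6 →
      10 ^ 4 + 40 - 5 * Real.log εb ≤ blo → 10 ^ 9 * (bhi + 4) ^ 4 ≤ F →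
      η * (10 ^ 9 * (bhi + 4) ^ 4 * (F + 1)) ≤ 1 → εb * (10 ^ 9 * (F + 1) ^ 2 * (bhi + 4) ^ 3) ≤ 1 →
      10 ^ 3 + 20 * Real.log (bhi + 5) + Real.log (F + 2) ≤ -Real.log εb →
      -- the critical system with memory errors on [0, T]
      n₀ ≤ n → 0 ≤ t₀ → t₀ < T → blo ≤ B → B ≤ bhi →
      (∀ k : ℤ, k < n₀ → ∀ t ∈ Icc 0 T, bv k t = 0 ∧ wv k t = 0 ∧ M0 k t = 0 ∧ M1 k t = 0) →
      (∀ k : ℤ, ContinuousOn (bv k) (Icc 0 T) ∧ ContinuousOn (wv k) (Icc 0 T) ∧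
        ContinuousOn (M0 k) (Icc 0 T) ∧ ContinuousOn (M1 k) (Icc 0 T)) →
      (∀ k : ℤ, ContinuousOn (db k) (Icc 0 T) ∧ ContinuousOn (dw k) (Icc 0 T) ∧
        ∀ t ∈ Ioo 0 T, HasDerivAt (bv k) (db k t) t ∧
          |db k t - R k * (-(bv k t) + G0 k t)| ≤ η * R k * M0 k t ∧
          HasDerivAt (wv k) (dw k t) t ∧ |dw k t - R k * (-(wv k t) + G1 k t)| ≤ η * R k * M1 k t) →
      (∀ k : ℤ, ∀ t ∈ Icc 0 T, |bv k t| ≤ M0 k t ∧ |wv k t| ≤ M1 k t ∧ 0 ≤ M0 k t ∧ 0 ≤ M1 k t) →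
      (∀ k : ℤ, ∀ t₁ ∈ Icc 0 T, ∀ t₂ ∈ Icc t₁ T,
        M0 k t₂ ≤ M0 k t₁ * Real.exp (-(θ * R k * (t₂ - t₁))) +
          R k * ∫ u in t₁..t₂, Real.exp (-(θ * R k * (t₂ - u))) * |G0 k u| ∧
        M1 k t₂ ≤ M1 k t₁ * Real.exp (-(θ * R k * (t₂ - t₁))) +
          R k * ∫ u in t₁..t₂, Real.exp (-(θ * R k * (t₂ - u))) * |G1 k u|) →
      -- the a-priori far tail above the front, and the hand-off invariant at t₀
      (∃ J : ℕ, ∀ j : ℕ, J ≤ j → ∀ t ∈ Icc 0 T,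
        |bv (n + j) t| ≤ lad j ∧ |wv (n + j) t| ≤ lad j / 5 ∧ M0 (n + j) t ≤ lad j ∧ M1 (n + j) t ≤ lad j) →
      Inv n B t₀ →
      (∃ t₁ ∈ Ioo t₀ T, t₁ ≤ t₀ + 4 / R n ∧ ∃ B' : ℝ, Inv (n + 1) B' t₁ ∧
        q * (B + Real.log εb - 6 * Real.log (B + 2) - 58) ≤ B' ∧
        B' ≤ q * (B + Real.log (10 * (F + 2) * εb * B) + 25) ∧
        (∀ t ∈ Icc t₀ t₁, Tube n t ∧ bv n t ≤ B + 3) ∧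
        (∃ tc ∈ Ioo t₀ t₁, (∀ s ∈ Ico t₀ tc, bv (n + 1) s < 1) ∧ bv (n + 1) tc = 1 ∧
          ∃ δ : ℝ, 0 < δ ∧ tc + δ ≤ t₁ ∧ ∀ s ∈ Ioc tc (tc + δ), 1 < bv (n + 1) s)) ∨
      (T < t₀ + 4 / R n ∧ ∀ t ∈ Icc t₀ T, Tube n t ∧ bv n t ≤ B + 3) := by
  intro hPre hPul hHand ε₀ D εb θ η F blo bhi n₀ bv wv M0 M1 db dw q R lad G0 G1 Inv Tube n B t₀ T hq hR hlad hG0 hG1 hInv hTube hε₀ hε₀' hD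
    hθ hθ' hη hεb hεb6 hblo hF hηreg hεbreg hlogreg hn₀ ht₀ ht₀T hBlo hBhi hvan hcont hC1 habs hrestart hTail hInv0
  have hPre' := hPre ε₀ D εb θ η F blo bhi n₀ bv wv M0 M1 db dw q R lad G0 G1 Inv Tube n B t₀ T hq hR hlad hG0 hG1 hInv hTube hε₀ hε₀' hD hθ hθ' hη hεb hεb6 hblo hF hηreg hεbreg hlogreg hn₀ ht₀ ht₀T hBlo hBhi hvan hcont hC1 habs hrestart hTail hInv0
  have hPul' := hPul ε₀ D εb θ η F blo bhi n₀ bv wv M0 M1 db dw q R lad G0 G1 Inv Tube n B t₀ T hq hR hlad hG0 hG1 hInv hTube hε₀ hε₀' hD hθ hθ' hη hεb hεb6 hblo hF hηreg hεbreg hlogreg hn₀ ht₀ ht₀T hBlo hBhi hvan hcont hC1 habs hrestart hTail hInv0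
  have hHand' := hHand ε₀ D εb θ η F blo bhi n₀ bv wv M0 M1 db dw q R lad G0 G1 Inv Tube n B t₀ T hq hR hlad hG0 hG1 hInv hTube hε₀ hε₀' hD hθ hθ' hη hεb hεb6 hblo hF hηreg hεbreg hlogreg hn₀ ht₀ ht₀T hBlo hBhi hvan hcont hC1 habs hrestart hTail hInv0
  clear hPre hPul hHand
  obtain ⟨hεb1, hB4, hB1, hF0, hFεB, hεbhi2, hq1, hq2⟩ := oneStepCore_regime hε₀ hε₀' hεb hεb6 hblo hF hεbreg hBlo hBhi hq
  have hlad0 : ∀ j : ℕ, 0 ≤ lad j := fun j => by rw [hlad]; positivity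
  have hvan' : ∀ t ∈ Icc t₀ T, ∀ k : ℤ, k < n₀ → bv k t = 0 ∧ wv k t = 0 ∧ M0 k t = 0 ∧ M1 k t = 0 :=
    fun t ht k hk => hvan k hk t ⟨ht₀.trans ht.1, ht.2⟩
  have hRpos : 0 < R n := by rw [hR]; positivity
  obtain ⟨hle3, hge0, h34, h3R, hdivc⟩ := oneStepCore_clock (t₀ := t₀) hRpos
  obtain ⟨hbt₀, -, ⟨hw0, hwF, -, -⟩, -⟩ := (hInv n B t₀).1 hInv0
  set tend : ℝ := min T (t₀ + 3 / R n) with htend_def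
  obtain ⟨htend1, htendT, htend3⟩ : t₀ < tend ∧ tend ≤ T ∧ tend ≤ t₀ + 3 / R n :=
    ⟨lt_min ht₀T (by linarith), min_le_left _ _, min_le_right _ _⟩
  have hg : ContinuousOn (fun s => (wv n s) ^ 2 - bv n s / 100) (Icc t₀ tend) :=
    (((hcont n).2.1.pow 2).sub ((hcont n).1.div_const 100)).mono (Icc_subset_Icc ht₀ htendT)
  have hg0 : (wv n t₀) ^ 2 - bv n t₀ / 100 < 0 := by
    rw [hbt₀]; linarith [oneStepCore_w0_sq_lt hεb hF0 hB1 hBhi hεbreg hw0 hwF]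
  rcases oneStepCore_first_zero hg hg0 with hno | ⟨tι, htι, hgι, hbefore⟩
  · have hpreig : ∀ s ∈ Icc t₀ tend, (wv n s) ^ 2 ≤ bv n s / 100 := fun s hs => by linarith [hno s hs]
    obtain ⟨hPreOn, -, -, hnew1, -⟩ := hPre' _ tend (fun _ => Iff.rfl) htend1 htendT htend3 hpreig
    rcases le_total T (t₀ + 3 / R n) with hT3 | hT3
    · have hte : tend = T := min_eq_left hT3
      refine Or.inr ⟨by linarith [div_lt_div_of_pos_right (by norm_num : (3:ℝ) < 4) hRpos], fun t ht => ?_⟩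
      have ht' : t ∈ Icc t₀ tend := by rw [hte]; exact ht
      exact oneStepCore_tube_of_pre ε₀ εb F bhi B n₀ n bv wv M0 M1 q R lad Tube t₀ t hTube hεb hεb1 hF0 hFεB hεbhi2 hq1 hq2 hB4 hBhi
        hlad0 hn₀ (hvan' t ht) (hge0 t ht.1) (hle3 t (ht'.2.trans htend3)) (hpreig t ht') (hPreOn t ht')
    · have h3 : R n * (tend - t₀) = 3 := by rw [htend_def, min_eq_right hT3]; field_simp; ring
      rw [h3] at hnew1
      exact (oneStepCore_no_ignition_contra hεb hεb1 hblo hBlo hnew1).elim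
  · have htι3 : tι ≤ t₀ + 3 / R n := htι.2.trans htend3
    have hτ3 : R n * (tι - t₀) ≤ 3 := hle3 tι htι3
    have hpreig : ∀ s ∈ Icc t₀ tι, (wv n s) ^ 2 ≤ bv n s / 100 := fun s hs => by
      rcases eq_or_lt_of_le hs.2 with h | h
      · rw [h]; linarith
      · linarith [hbefore s ⟨hs.1, h⟩]
    have hign : (wv n tι) ^ 2 = bv n tι / 100 := by linarith
    obtain ⟨hPreOn, hpos, hint, hnew1, hnew2⟩ := hPre' _ tι (fun _ => Iff.rfl) htι.1 (htι.2.trans htendT) htι3 hpreig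
    have hnew2' := hnew2 hign.symm.le
    obtain ⟨⟨henv_lo, henv_hi, -⟩, -⟩ := hPreOn tι ⟨htι.1.le, le_rfl⟩
    have hBp : 10 ^ 4 ≤ bv n tι := oneStepCore_Bp_ge hεb hεb1 hblo hBlo hτ3 hnew1 henv_lo
    have hσI := hdivc _ _ _ (oneStepCore_sigmaI_le hεb hF0 hB1 hBhi hτ3 hlogreg hnew2' henv_lo)
    obtain ⟨hσP0, hσP1⟩ := oneStepCore_sigmaP_bounds hBp
    have hσR1 : (5 * Real.log (bv n tι) + 20) / bv n tι / R n ≤ 1 / R n := div_le_div_of_nonneg_right hσP1 hRpos.le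
    have hbι0 : 0 ≤ bv n tι := le_trans (by positivity) hBp
    have hbι : bv n tι ≤ B + 5 / 2 := by linarith [oneStepCore_mul_exp_neg_le (by linarith : (0:ℝ) ≤ B) (hge0 tι htι.1.le)]
    by_cases hfull : tι + (5 * Real.log (bv n tι) + 20) / bv n tι / R n ≤ T
    · have hPulOn := hPul' _ _ tι (tι + (5 * Real.log (bv n tι) + 20) / bv n tι / R n) (fun _ => Iff.rfl)
        (fun _ => Iff.rfl) htι.1 htι3 hσI hBp hPreOn hpos hint hpreig hign hnew2' hnew1
        (by linarith [div_pos hσP0 hRpos]) hfull le_rfl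
      exact Or.inl (hHand' _ _ tι (fun _ => Iff.rfl) (fun _ => Iff.rfl) htι.1 htι3 hσI hBp hPreOn hpos hint hpreig hign hnew2' hnew1 hfull hPulOn)
    · push Not at hfull
      refine Or.inr ⟨by linarith, fun t ht => ?_⟩
      rcases le_or_gt t tι with htle | htgt
      · exact oneStepCore_tube_of_pre ε₀ εb F bhi B n₀ n bv wv M0 M1 q R lad Tube t₀ t hTube hεb hεb1 hF0 hFεB hεbhi2 hq1 hq2 hB4 hBhi
          hlad0 hn₀ (hvan' t ht) (hge0 t ht.1) (hle3 t (htle.trans htι3)) (hpreig t ⟨ht.1, htle⟩) (hPreOn t ⟨ht.1, htle⟩)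
      · have hPulOn := hPul' _ _ tι T (fun _ => Iff.rfl) (fun _ => Iff.rfl) htι.1 htι3 hσI hBp hPreOn hpos hint hpreig hign hnew2'
          hnew1 (lt_of_lt_of_le htgt ht.2) le_rfl hfull.le
        exact oneStepCore_tube_of_pul ε₀ εb F bhi B n₀ n bv wv M0 M1 q R lad Tube t₀ t tι hTube hεb hεb1 hF0 hFεB hεbhi2 hq1 hq2 hB4
          hBhi hlad0 hn₀ (hvan' t ht) hbι0 hbι (hPulOn t ⟨htgt.le, ht.2⟩)

/-- **Registered marker stub of this file** (`stub_oneStepCoreMarker`): the pulse horizon is at most one slow unit. [folklore] -/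
theorem stub_oneStepCoreMarker : ∀ x : ℝ, 10 ^ 4 ≤ x → (5 * Real.log x + 20) / x ≤ 1 := fun _ hx => (oneStepCore_sigmaP_bounds hx).2

end Summit.NavierStokesRegularity.NavierStokesRegularity.Theorems.PerpetualPumpAveragedTypeIBlowup
end
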